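import Mathlib
import HarnessLib
import HarnessLib.Audit

/-!
# ValiantsHypothesis / LacunarySymmetroid — crux `MatrixDescartes` (stmt-ValiantsHypothesis-18050, V1), LINE (A) «product_plus_one»:
# the BINOMIAL-LIMIT TOY of the A-function — definitions

Source: pen val-idea-25 g8, NOTE §54.12–§54.13 «TOY THEOREM: in the binomial limit the A-LAW holds with the sharp
constant 2r − 1» (`pub/ideators/val-idea-25/NOTE-idea25g3-18050-LINEA-AB-reduction.md` ll. 2664–2673, 2026-08-29).

For `r` rows with `t_f > 0`, weights `λ_f` and a parameter `τ` (in the pen's setting `λ_f > 0`, `τ = ξ/(1−ξ) > 0`), the toy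
A-function is `A_toy(Y) = Σ_f λ_f t_f² (Y − τ t_f)/(Y + t_f)³` (`Y = e^x`, `t_f = e^{u_f}`; the `η_f → 0` limit of
`A/(1−ξ)`, NOTE 54.12).  This file defines `toyA`, its numerator polynomial `toyNum` over the common denominator
`toyDen = ∏_f (Y + t_f)³`, and proves the bookkeeping identity `toyA = toyNum / toyDen` away from the poles.  The TOY THEOREM
(`toyNum` has at most `2r − 1` positive roots counted with multiplicity) is proved in `…ToyALawMain`; the objects `ladderNum`,
`ladderDen` of the pen's POLYNOMIAL LADDER (NOTE §54.15(b), the degree-`n` generalisation) are defined here too.  This file also holds the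
TOOL DEFINITIONS of the proof chain (so that the later modules are pure-proof files): `SignChangesLE φ S R` (at most `R`
sign changes of `φ` along chains of points of `S` — Pólya–Szegő's `V(φ) ≤ R` without multiplicities), `IsAltChain`, the operator
`phiOp u Q = u·Q + Q′` on `ℝ[X]`, and the real exponential polynomial `expPoly S P θ = Σ_{s∈S} e^{sθ} P_s(θ)`.

HONEST FRAMING: definitions about the `η → 0` toy of LINE (A)'s A-function (NOTE 54.12: «not about the crux's objects except
in a limit»); no stub of LINE (A) is touched; `MatrixDescartes` OPEN; `VP ≠ VNP` is NOT proved and nothing here bears on it.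
-/

set_option linter.dupNamespace false

namespace Summit.ValiantsHypothesis.ValiantsHypothesis.Theorems.LacunarySymmetroidMatrixDescartes

namespace ToyALaw

open Polynomial Finset

noncomputable section

/-- The toy A-function `A_toy(Y) = Σ_f λ_f t_f² (Y − τ t_f)/(Y + t_f)³` (pen NOTE §54.13; `Y = e^x`, `t_f = e^{u_f}`). -/
def toyA {r : ℕ} (t lam : Fin r → ℝ) (τ : ℝ) (Y : ℝ) : ℝ :=
  ∑ f, lam f * t f ^ 2 * (Y - τ * t f) / (Y + t f) ^ 3

/-- The same function with the row count explicit, in the exact form typed by the pen in the crux idea card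
`Cruxes/MatrixDescartes/Ideas/strip-identity-binomial-vd.md` (`Atoy r t lam τ Y`); see `Atoy_eq_toyA`. -/
def Atoy (r : ℕ) (t lam : Fin r → ℝ) (τ Y : ℝ) : ℝ :=
  ∑ f, lam f * (t f) ^ 2 * (Y - τ * t f) / (Y + t f) ^ 3

/-- The numerator polynomial of `A_toy` over the common denominator `∏_f (Y + t_f)³`:
`toyNum = Σ_f λ_f t_f² (X − τ t_f) ∏_{f' ≠ f} (X + t_{f'})³` (degree `≤ 3r − 2`). -/
def toyNum {r : ℕ} (t lam : Fin r → ℝ) (τ : ℝ) : ℝ[X] :=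
  ∑ f, C (lam f * t f ^ 2) * (X - C (τ * t f)) * ∏ f' ∈ univ.erase f, (X + C (t f')) ^ 3

/-- The common denominator `toyDen = ∏_f (X + t_f)³`. -/
def toyDen {r : ℕ} (t : Fin r → ℝ) : ℝ[X] := ∏ f, (X + C (t f)) ^ 3

/-- POLYNOMIAL LADDER objects (pen NOTE §54.15(b)): for rows `H_f ∈ ℝ[X]` of degree `≤ n` evaluated along the Möbius pencil
`p_f = t_f/(Y + t_f)`, the numerator of `Σ_f H_f(t_f/(Y + t_f))` over the common denominator `ladderDen = ∏_f (X + t_f)^n`: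
`ladderNum = Σ_f (Σ_{k ≤ n} H_f[k]·t_f^k·(X + t_f)^{n−k}) · ∏_{f' ≠ f} (X + t_{f'})^n` (see `ladder_eval_div` in `…ToyALawLadder`). -/
def ladderNum {r : ℕ} (n : ℕ) (t : Fin r → ℝ) (H : Fin r → ℝ[X]) : ℝ[X] :=
  ∑ f, (∑ k ∈ Finset.range (n + 1), C ((H f).coeff k * t f ^ k) * (X + C (t f)) ^ (n - k)) *
    ∏ f' ∈ univ.erase f, (X + C (t f')) ^ n

/-- The ladder's common denominator `∏_f (X + t_f)^n`. -/
def ladderDen {r : ℕ} (n : ℕ) (t : Fin r → ℝ) : ℝ[X] := ∏ f, (X + C (t f)) ^ n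

variable {r : ℕ} (t lam : Fin r → ℝ) (τ : ℝ)

/-- The pen's `Atoy` is `toyA`. -/
theorem Atoy_eq_toyA (Y : ℝ) : Atoy r t lam τ Y = toyA t lam τ Y := rfl

/-- `toyDen(Y) = ∏_f (Y + t_f)³`. -/
theorem toyDen_eval (Y : ℝ) : (toyDen t).eval Y = ∏ f, (Y + t f) ^ 3 := by
  simp [toyDen, eval_prod]

/-- `toyDen(Y) > 0` as soon as every `Y + t_f > 0` (in particular for `Y > 0` when all `t_f > 0`). -/
theorem toyDen_eval_pos {Y : ℝ} (h : ∀ f, 0 < Y + t f) : 0 < (toyDen t).eval Y := by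
  rw [toyDen_eval]
  exact prod_pos fun f _ => pow_pos (h f) 3

/-- `toyDen(Y) ≠ 0` away from the poles `Y = −t_f`. -/
theorem toyDen_eval_ne_zero {Y : ℝ} (h : ∀ f, Y + t f ≠ 0) : (toyDen t).eval Y ≠ 0 := by
  rw [toyDen_eval]
  exact prod_ne_zero_iff.2 fun f _ => pow_ne_zero 3 (h f)

/-- `toyNum(Y) = Σ_f λ_f t_f² (Y − τ t_f) ∏_{f' ≠ f} (Y + t_{f'})³`. -/
theorem toyNum_eval (Y : ℝ) :
    (toyNum t lam τ).eval Y = ∑ f, lam f * t f ^ 2 * (Y - τ * t f) * ∏ f' ∈ univ.erase f, (Y + t f') ^ 3 := by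
  simp [toyNum, eval_finsetSum, eval_prod]

/-- The bookkeeping identity `A_toy(Y) = toyNum(Y)/toyDen(Y)` away from the poles; hence on `(0, ∞)` (all `t_f > 0`) the zeros
of `A_toy` counted with multiplicity are exactly the positive roots of `toyNum` counted with multiplicity. -/
theorem toyA_eq_div {Y : ℝ} (h : ∀ f, Y + t f ≠ 0) :
    toyA t lam τ Y = (toyNum t lam τ).eval Y / (toyDen t).eval Y := by
  rw [toyNum_eval, toyDen_eval, toyA, sum_div]
  refine sum_congr rfl fun f _ => ?_
  rw [← mul_prod_erase univ (fun f' => (Y + t f') ^ 3) (mem_univ f)]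
  have h3 : (Y + t f) ^ 3 ≠ 0 := pow_ne_zero 3 (h f)
  have hP : ∏ f' ∈ univ.erase f, (Y + t f') ^ 3 ≠ 0 :=
    prod_ne_zero_iff.2 fun f' _ => pow_ne_zero 3 (h f')
  field_simp

/-! ## Tool definitions used by the proof chain (modules `…ToyALawSignChanges`, `…ToyALawExpPoly`, …) -/

/-- `φ` has at most `R` sign changes on `S` (`V_S(φ) ≤ R`): along every chain `x 0 < ⋯ < x (R+1)` of `R + 2` points of `S`
some consecutive pair is NOT a strict sign alternation, i.e. `0 ≤ φ (x i) * φ (x (i+1))` for some `i ≤ R`. -/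
def SignChangesLE (φ : ℝ → ℝ) (S : Set ℝ) (R : ℕ) : Prop :=
  ∀ x : ℕ → ℝ, (∀ i ≤ R + 1, x i ∈ S) → (∀ i ≤ R, x i < x (i + 1)) →
    ∃ i ≤ R, 0 ≤ φ (x i) * φ (x (i + 1))

/-- An alternating chain with `n` sign changes: `n + 1` points `x 0 < x 1 < ⋯ < x n` of `S` with
`φ (x i) * φ (x (i+1)) < 0` for all `i < n`.  (`SignChangesLE φ S R` says exactly that no `x` is an alternating chain with
`R + 1` sign changes; used to extract a maximal chain in `…ToyALawMultiplier`.) -/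
def IsAltChain (φ : ℝ → ℝ) (S : Set ℝ) (n : ℕ) (x : ℕ → ℝ) : Prop :=
  (∀ i ≤ n, x i ∈ S) ∧ (∀ i < n, x i < x (i + 1)) ∧ (∀ i < n, φ (x i) * φ (x (i + 1)) < 0)

/-- `Φ_u Q = u·Q + Q′`, so that `d/dθ (e^{uθ} Q(θ)) = e^{uθ} (Φ_u Q)(θ)`. -/
def phiOp (u : ℝ) (Q : ℝ[X]) : ℝ[X] := C u * Q + derivative Q

/-- The real exponential polynomial `h_{S,P}(θ) = Σ_{s∈S} e^{sθ} · P_s(θ)`. -/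
def expPoly (S : Finset ℝ) (P : ℝ → ℝ[X]) (θ : ℝ) : ℝ :=
  ∑ s ∈ S, Real.exp (s * θ) * (P s).eval θ

end

end ToyALaw

end Summit.ValiantsHypothesis.ValiantsHypothesis.Theorems.LacunarySymmetroidMatrixDescartes
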